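import Mathlib
import Summits.Ventures.PercRepro.TriangleCapCherryMantel

/-!
# PercRepro — the cherry envelope on `K₄⁻`-free graphs: `Σ_v C(d(v), 2) ≤ m(k−1)/2` (p3, gen 28)

The class of ROW C-047 is the `K₄⁻`-free graphs (`K4mFree`: at most `4` edges on every `4` vertices).  On that
class two adjacent vertices have at most ONE common neighbour (two common neighbours `x ≠ y` of an edge `vw`
give `5` edges on `{v, w, x, y}`), so `d(v) + d(w) = |N(v) ∪ N(w)| + |N(v) ∩ N(w)| ≤ k + 1` on every edge, and
the degree-sum count of TriangleCapCherryMantel gives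

* `card_inter_le_one_of_adj` — `|N(v) ∩ N(w)| ≤ 1` for `v ~ w` in a `K₄⁻`-free graph;
* `deg_add_deg_le_succ_of_adj` — `d(v) + d(w) ≤ k + 1` on every edge;
* `sum_deg_mul_deg_le_of_k4mFree` — `Σ_v d(v)² ≤ m (k + 1)`;
* **`diamond_cherries`** — `2·Σ_v C(d(v), 2) + 2m ≤ m (k + 1)`, i.e. `Σ_v C(d(v), 2) ≤ m(k−1)/2`
  (`cherries_le_of_k4mFree`, `k ≥ 1`), for every `K₄⁻`-free graph on `k` vertices with `m` edges.

With `mantel_eq_bip` this places the (open) exact `K₄⁻`-free cherry maximum at `(k, m)` between the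
complete-bipartite value `m(k−2)/2` (when `m = a(k−a)`) and `m(k−1)/2`; ROW C-047's `B_k(m)` lies below the
lower end for every `c ≥ 3` and large `k` (P3-TRIANGLE-CAP.md §10x).  Axioms: standard.
-/

namespace PercRepro

namespace TriangleCap

namespace C047

open Finset

variable {V : Type*} [Fintype V] [DecidableEq V]

omit [Fintype V] [DecidableEq V] in
/-- The ordered adjacent pairs inside `S`, summed vertex by vertex. -/
theorem adjPairs_eq_sum (D : SimpleGraph V) [DecidableRel D.Adj] (S : Finset V) :
    adjPairs D S = ∑ u ∈ S, (S.filter (fun x => D.Adj u x)).card := by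
  unfold adjPairs
  rw [card_filter, sum_product]
  apply sum_congr rfl
  intro u _
  rw [card_filter]

omit [Fintype V] in
/-- Three vertices of `S` adjacent to `u` give `3 ≤ |{x ∈ S : u ~ x}|`. -/
theorem three_le_card_filter_adj (D : SimpleGraph V) [DecidableRel D.Adj] (S : Finset V) {u a b c : V}
    (ha : a ∈ S) (hb : b ∈ S) (hc : c ∈ S) (hab : a ≠ b) (hac : a ≠ c) (hbc : b ≠ c)
    (hua : D.Adj u a) (hub : D.Adj u b) (huc : D.Adj u c) :
    3 ≤ (S.filter (fun x => D.Adj u x)).card := by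
  have hsub : ({a, b, c} : Finset V) ⊆ S.filter (fun x => D.Adj u x) := by
    intro x hx
    rw [mem_filter]
    simp only [mem_insert, mem_singleton] at hx
    rcases hx with rfl | rfl | rfl
    · exact ⟨ha, hua⟩
    · exact ⟨hb, hub⟩
    · exact ⟨hc, huc⟩
  have hcard : ({a, b, c} : Finset V).card = 3 := by
    rw [card_insert_of_notMem, card_pair hbc]
    simp only [mem_insert, mem_singleton, not_or]
    exact ⟨hab, hac⟩
  rw [← hcard]
  exact card_le_card hsub

omit [Fintype V] in
/-- Two vertices of `S` adjacent to `u` give `2 ≤ |{x ∈ S : u ~ x}|`. -/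
theorem two_le_card_filter_adj (D : SimpleGraph V) [DecidableRel D.Adj] (S : Finset V) {u a b : V}
    (ha : a ∈ S) (hb : b ∈ S) (hab : a ≠ b) (hua : D.Adj u a) (hub : D.Adj u b) :
    2 ≤ (S.filter (fun x => D.Adj u x)).card := by
  have hsub : ({a, b} : Finset V) ⊆ S.filter (fun x => D.Adj u x) := by
    intro x hx
    rw [mem_filter]
    simp only [mem_insert, mem_singleton] at hx
    rcases hx with rfl | rfl
    · exact ⟨ha, hua⟩
    · exact ⟨hb, hub⟩
  rw [← card_pair hab]
  exact card_le_card hsub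

/-- In a `K₄⁻`-free graph two adjacent vertices have at most one common neighbour. -/
theorem card_inter_le_one_of_adj (D : SimpleGraph V) [DecidableRel D.Adj] (hK : K4mFree D) {v w : V}
    (h : D.Adj v w) :
    ((univ.filter (fun x => D.Adj v x)) ∩ (univ.filter (fun x => D.Adj w x))).card ≤ 1 := by
  by_contra hlt
  obtain ⟨x, hx, y, hy, hxy⟩ := one_lt_card.mp (Nat.lt_of_not_le hlt)
  rw [mem_inter, mem_filter, mem_filter] at hx hy
  have hvx : D.Adj v x := hx.1.2
  have hwx : D.Adj w x := hx.2.2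
  have hvy : D.Adj v y := hy.1.2
  have hwy : D.Adj w y := hy.2.2
  have hvw : v ≠ w := h.ne
  have hvx' : v ≠ x := hvx.ne
  have hwx' : w ≠ x := hwx.ne
  have hvy' : v ≠ y := hvy.ne
  have hwy' : w ≠ y := hwy.ne
  set S : Finset V := {v, w, x, y} with hS
  have hw : w ∉ ({x, y} : Finset V) := by
    simp only [mem_insert, mem_singleton, not_or]
    exact ⟨hwx', hwy'⟩
  have hv : v ∉ ({w, x, y} : Finset V) := by
    simp only [mem_insert, mem_singleton, not_or]
    exact ⟨hvw, hvx', hvy'⟩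
  have hcard : S.card = 4 := by
    rw [hS, card_insert_of_notMem hv, card_insert_of_notMem hw, card_pair hxy]
  have hle := hK S hcard
  rw [adjPairs_eq_sum, hS, sum_insert hv, sum_insert hw, sum_pair hxy] at hle
  have hmv : v ∈ S := by simp [hS]
  have hmw : w ∈ S := by simp [hS]
  have hmx : x ∈ S := by simp [hS]
  have hmy : y ∈ S := by simp [hS]
  have h1 := three_le_card_filter_adj D S hmw hmx hmy hwx' hwy' hxy h hvx hvy
  have h2 := three_le_card_filter_adj D S hmv hmx hmy hvx' hvy' hxy h.symm hwx hwy
  have h3 := two_le_card_filter_adj D S hmv hmw hvw hvx.symm hwx.symm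
  have h4 := two_le_card_filter_adj D S hmv hmw hvw hvy.symm hwy.symm
  rw [hS] at h1 h2 h3 h4
  omega

/-- On every edge of a `K₄⁻`-free graph, `d(v) + d(w) ≤ k + 1`. -/
theorem deg_add_deg_le_succ_of_adj (D : SimpleGraph V) [DecidableRel D.Adj] (hK : K4mFree D) {v w : V}
    (h : D.Adj v w) : deg D v + deg D w ≤ Fintype.card V + 1 := by
  have h1 := card_union_add_card_inter (univ.filter (fun x => D.Adj v x)) (univ.filter (fun x => D.Adj w x))
  have h2 := card_inter_le_one_of_adj D hK h
  have h3 := card_le_univ ((univ.filter (fun x => D.Adj v x)) ∪ (univ.filter (fun x => D.Adj w x)))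
  unfold deg
  omega

/-- `Σ_v d(v)² ≤ m (k + 1)` for a `K₄⁻`-free graph on `k` vertices with `m` edges. -/
theorem sum_deg_mul_deg_le_of_k4mFree (D : SimpleGraph V) [DecidableRel D.Adj] (hK : K4mFree D) :
    ∑ v, deg D v * deg D v ≤ D.edgeFinset.card * (Fintype.card V + 1) := by
  have h1 : ∑ p ∈ adjPairsAll D, (deg D p.1 + deg D p.2) = 2 * ∑ v, deg D v * deg D v := by
    rw [sum_add_distrib, sum_snd_adjPairsAll, sum_fst_adjPairsAll]
    ring
  have h2 : ∑ p ∈ adjPairsAll D, (deg D p.1 + deg D p.2) ≤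
      ∑ p ∈ adjPairsAll D, (Fintype.card V + 1) :=
    sum_le_sum (fun p hp => deg_add_deg_le_succ_of_adj D hK (mem_filter.mp hp).2)
  rw [sum_const, smul_eq_mul, card_adjPairsAll, h1, mul_assoc] at h2
  exact Nat.le_of_mul_le_mul_left h2 (by norm_num)

/-- **THE CHERRY ENVELOPE ON `K₄⁻`-FREE GRAPHS:** `2·Σ_v C(d(v), 2) + 2m ≤ m (k + 1)`. -/
theorem diamond_cherries (D : SimpleGraph V) [DecidableRel D.Adj] (hK : K4mFree D) :
    2 * cherries D + 2 * D.edgeFinset.card ≤ D.edgeFinset.card * (Fintype.card V + 1) := by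
  have h := sum_deg_mul_deg_le_of_k4mFree D hK
  rw [← two_mul_cherries_add, sum_deg_eq] at h
  exact h

/-- `Σ_v C(d(v), 2) ≤ m(k−1)/2` for a `K₄⁻`-free graph on `k ≥ 1` vertices with `m` edges. -/
theorem cherries_le_of_k4mFree (D : SimpleGraph V) [DecidableRel D.Adj] (hK : K4mFree D)
    (hk : 1 ≤ Fintype.card V) :
    cherries D ≤ D.edgeFinset.card * (Fintype.card V - 1) / 2 := by
  have h := diamond_cherries D hK
  obtain ⟨k, hk'⟩ := Nat.exists_eq_add_of_le hk
  rw [hk'] at h ⊢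
  rw [Nat.add_sub_cancel_left, Nat.le_div_iff_mul_le (by norm_num)]
  nlinarith [h]

end C047

end TriangleCap

end PercRepro
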